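import Mathlib
import Summits.KontsevichZagierPeriods.Zeta5Search.Families.ExactS7cValue
import Summits.KontsevichZagierPeriods.Zeta5Search.Families.ExactS8lValue
import Summits.KontsevichZagierPeriods.Zeta5Search.Families.BasicGrowthFive
import Summits.KontsevichZagierPeriods.Zeta5Search.Families.BasicGrowthSix
import HarnessLib

/-!
# ζ(5) search — Families: radical closed forms in the exact atlas — `M_{S7c} = φ^{-10} = M_{₅π}²`, `M_{S8l} = (√2−1)^8 = M_{₆π}²`

HONEST FRAMING: systematic search; no irrationality claim unless certified.  STRUCTURAL facts about the size of
Brown's basic cellular integrals [Brown2016, §1.5] (seat P2, Families layer); nothing about the arithmetic of any zeta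
value.

Two quadratic entries of the exact atlas in radicals:
* **`fSup_S7c_eq`** — the `N = 7` configuration `sigmaS7c = (0,2,5,1,3,6,4)` (self-dual class) has
  `M = (123 − 55√5)/2 = ((√5−1)/2)^{10} = φ^{-10}`, the SQUARE of the growth constant `φ^{-5}` of Brown's `N = 5` plan
  (`fSup_sigma5`, Beukers' `ζ(2)` integrals): `fSup_S7c_eq_fSup_sigma5_sq`;
* **`fSup_S8l_eq`** — the `N = 8` configuration `sigmaS8l = (0,3,6,1,4,7,2,5)` (self-dual class) has
  `M = 577 − 408√2 = (√2−1)^8`, the SQUARE of the growth constant `(√2−1)^4` of Brown's `N = 6` plan (`fSup_sigma6`,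
  Apéry's `ζ(3)` integrals): `fSup_S8l_eq_fSup_sigma6_sq`.
(From `minpoly_fSup_S7c : M² − 123M + 1 = 0`, `minpoly_fSup_S8l : M² − 1154M + 1 = 0` and `M < 1`.)  Standard axioms only.
-/

noncomputable section

open MeasureTheory Set Finset Filter Topology

namespace Summit.KontsevichZagierPeriods.Zeta5Search.Families.Cellular

/-- **`M_{S7c} = ((√5 − 1)/2)^{10}`** (`= φ^{-10} = (123 − 55√5)/2 = 0.0081306…`). -/
theorem fSup_S7c_eq : fSup sigmaS7c = ((Real.sqrt 5 - 1) / 2) ^ 10 := by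
  have hs : Real.sqrt 5 ^ 2 = 5 := Real.sq_sqrt (by norm_num)
  have hs0 : 0 ≤ Real.sqrt 5 := Real.sqrt_nonneg 5
  have hs2 : 2 < Real.sqrt 5 := by nlinarith [hs, hs0]
  set M := fSup sigmaS7c with hM
  have hp : 1 - 123 * M + M ^ 2 = 0 := by
    have h := minpoly_fSup_S7c
    unfold minpolyS7c at h
    linear_combination h
  have hlt : M < 1 := by have := fSup_S7c_mem_Ioo.2; norm_num at this; linarith
  -- `(M − r₁)(M − r₂) = minpoly`, `r₁ = (123 − 55√5)/2`, `r₂ = (123 + 55√5)/2 > 1`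
  have hfac : (M - (123 - 55 * Real.sqrt 5) / 2) * (M - (123 + 55 * Real.sqrt 5) / 2) = 0 := by
    linear_combination hp - (3025 / 4) * hs
  have hr2 : M - (123 + 55 * Real.sqrt 5) / 2 ≠ 0 := by nlinarith [hs0, hlt]
  have hM1 : M = (123 - 55 * Real.sqrt 5) / 2 := by
    rcases mul_eq_zero.1 hfac with h | h
    · linarith
    · exact absurd h hr2
  rw [hM1]
  -- `((√5−1)/2)^10 = (123 − 55√5)/2`
  have h2 : ((Real.sqrt 5 - 1) / 2) ^ 2 = (3 - Real.sqrt 5) / 2 := by linear_combination (1 / 4) * hs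
  have h10 : ((Real.sqrt 5 - 1) / 2) ^ 10 = (((Real.sqrt 5 - 1) / 2) ^ 2) ^ 5 := by ring
  rw [h10, h2]
  linear_combination ((1 : ℝ) / 32 * (Real.sqrt 5 ^ 3 - 15 * Real.sqrt 5 ^ 2 + 95 * Real.sqrt 5 - 345)) * hs

/-- **`M_{S7c} = M_{₅π}²`**: the growth constant of `sigmaS7c` is the square of that of Brown's five-point plan
(`fSup_sigma5 = ((√5−1)/2)^5`). -/
theorem fSup_S7c_eq_fSup_sigma5_sq : fSup sigmaS7c = fSup sigma5 ^ 2 := by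
  rw [fSup_S7c_eq, fSup_sigma5]; ring

/-- **`M_{S8l} = (√2 − 1)^8`** (`= 577 − 408√2 = 0.00086655…`). -/
theorem fSup_S8l_eq : fSup sigmaS8l = (Real.sqrt 2 - 1) ^ 8 := by
  have hs : Real.sqrt 2 ^ 2 = 2 := Real.sq_sqrt (by norm_num)
  have hs0 : 0 ≤ Real.sqrt 2 := Real.sqrt_nonneg 2
  have hs1 : 1 < Real.sqrt 2 := by nlinarith [hs, hs0]
  set M := fSup sigmaS8l with hM
  have hp : 1 - 1154 * M + M ^ 2 = 0 := by
    have h := minpoly_fSup_S8l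
    unfold minpolyS8l at h
    linear_combination h
  have hlt : M < 1 := by have := fSup_S8l_mem_Ioo.2; norm_num at this; linarith
  have hfac : (M - (577 - 408 * Real.sqrt 2)) * (M - (577 + 408 * Real.sqrt 2)) = 0 := by
    linear_combination hp - 166464 * hs
  have hr2 : M - (577 + 408 * Real.sqrt 2) ≠ 0 := by nlinarith [hs0, hlt]
  have hM1 : M = 577 - 408 * Real.sqrt 2 := by
    rcases mul_eq_zero.1 hfac with h | h
    · linarith
    · exact absurd h hr2
  rw [hM1]
  have h2 : (Real.sqrt 2 - 1) ^ 2 = 3 - 2 * Real.sqrt 2 := by linear_combination hs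
  have h8 : (Real.sqrt 2 - 1) ^ 8 = ((Real.sqrt 2 - 1) ^ 2) ^ 4 := by ring
  rw [h8, h2]
  linear_combination (-(16 * Real.sqrt 2 ^ 2) + 96 * Real.sqrt 2 - 248) * hs

/-- **`M_{S8l} = M_{₆π}²`**: the growth constant of `sigmaS8l` is the square of that of Brown's six-point plan
(`fSup_sigma6 = (√2−1)^4`, Apéry). -/
theorem fSup_S8l_eq_fSup_sigma6_sq : fSup sigmaS8l = fSup sigma6 ^ 2 := by
  rw [fSup_S8l_eq, fSup_sigma6]; ring

end Summit.KontsevichZagierPeriods.Zeta5Search.Families.Cellular
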